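import Summits.BirchSwinnertonDyer.Rank1Residual.Additive.TameBranchAnalyticShaOddPrimeConverse
import Summits.BirchSwinnertonDyer.Rank1Residual.Supersingular.DescentLowerBound
import HarnessLib

/-!
# ONE NON-ZERO `p`-SELMER CLASS IS THE CERTIFICATE WHERE `p ∣ #Ш_an` — the native `p`-descent line
# `Sel^(p)(E/ℚ) ≠ 0` (equivalently one non-zero `p`-torsion element of `Ш(E/ℚ)`), upgraded by
# Cassels–Tate squareness, IS the lower half `ord_p #Ш_an ≤ ord_p #Ш[p^∞]` on the `ord_p #Ш_an = 2` rows,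
# hence `BSD(E,p)` AND the main conjecture at the pair AND `ℓ = 1` on X4♯(G-ord, `e = 2`) (every odd `p`),
# X4(M), X3♯(M), X3♯(G-ord, `e = 2`) (cell `b2b-bsdres`, sub-cell additive-p2, gen 33; part 4)

HONEST FRAMING (cell `b2b-bsdres`, run/shared/lean/b2b/bsd-rank1-residual/, verbatim in every
file): the goal of the cell is to DELETE the COMBINATION-SHAPED residual classes of the
Birch–Swinnerton-Dyer formula for ALL analytic-rank `≤ 1` elliptic curves over `ℚ` — "full BSD
formula for every rank `≤ 1` curve in class `C`" assembled STRICTLY from published theorems — so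
that the rank-`≤ 1` remainder becomes exactly the CONSTRUCTION-SHAPED classes, which are TYPED
(missing-input `Prop`s), NOT attempted. This is not "finishing BSD". Sub-cell additive-p2: the
classes X3♯(G-ord) / X4♯(G-ord) are CONSTRUCTION-SHAPED and stay so; labels / RESIDUAL-MAP marks
UNCHANGED; nothing is booked: the theorems below are PER-PAIR CERTIFICATE CONSUMERS — the certificate
line `Sel^(p)(E/ℚ) ≠ 0` / "a non-zero `x ∈ Ш(E/ℚ)` with `p·x = 0`" / `p^{2k−1} ∣ #Ш(E/ℚ)` is a HYPOTHESIS
produced per curve by a `p`-descent (the cell's two exact `3`-descent engines at `p = 3`; none at `p = 5`);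
the referee rules on pairs. Theorems only; published inputs are explicit binders (`hK` Kato 2004
Thm. 17.4 (3) / `hWu` Wuthrich 2014 Thm. 16, `hCT` Cassels 1962 = `exists_casselsTate_pairing`, `hGZK`,
`hmod`, the (B)-datum `LeadingTermClauses W p Dh`). No definition, no named fact, no `sorry`.

## What and why

Gen 32 parts 6/8 and gen 33 part 2 reduced `BSD(E,p)` + the main conjecture at the pair + `ℓ = 1` on the
rank-0 defect-2 rows with `p ∣ #Ш_an(E)` to ONE input: a LOWER bound `ord_p #Ш_an ≤ ord_p #Ш(E/ℚ)[p^∞]`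
("no Euler system supplies it"). THIS FILE names the certificate that DOES supply it and plugs it in:

* §0 (class-free sockets) `padicValRat_le_card_primaryComponent_of_missingLowerBoundAt`: the typed
  `MissingLowerBoundAt W p` (x11b / x10b currency) IS the socket hypothesis `ord_p s ≤ ord_p #Ш[p^∞]`
  once `Ш` is finite (GZK); `…_of_pow_dvd_shaOrder` (`ord_p s ≤ 2k`, `p^{2k−1} ∣ #Ш`: Cassels–Tate
  squareness makes the odd step free — x11b's `missingLowerBoundAt_of_casselsTate_of_pow_dvd`);
  `…_of_exists_sha_torsion` (`ord_p s ≤ 2`, ONE non-zero `x ∈ Ш(E/ℚ)[p]`); `…_of_selmerGroup_ne_bot`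
  (`ord_p s ≤ 2`, rank `0`, `p ∤ #E(ℚ)_tors`, `Sel^(p)(E/ℚ) ≠ 0` — x10b's class-free
  `Supersingular.missingLowerBoundAt_of_casselsTate_of_selmerGroup_ne_bot` on the PROVED fundamental
  descent sequence).
* §1 X4♯(G-ord, `e = 2`) ∩ {`ρ̄` onto}, EVERY odd `p` ((B)-datum a binder; `p ∤ #E(ℚ)_tors` automatic from
  `Irr`): **`Sel^(p)(E/ℚ) ≠ 0` ∧ `ord_p #Ш_an ≤ 2` ⟹ `BSD(E,p)` ∧ `ord_p #Ш[p^∞] = ord_p #Ш_an` ∧ the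
  Kato element generates `char_Λ X(E/ℚ_∞)` ∧ `ℓ = 1`**
  (`ClassX4Gord.bsdp_and_charIdeal_eq_span_kato_of_selmerGroup_ne_bot_rankZero_odd`); the `p^{2k−1} ∣ #Ш`
  form for `ord_p #Ш_an ≤ 2k` (`…_of_pow_dvd_shaOrder_rankZero_odd`; census: 19215t1 at `3`, `#Ш_an = 81`).
* §2 X4(M) ∩ {`ρ̄` onto}, every odd `p`: the same from `Sel^(p)(E/ℚ) ≠ 0` (gen 32 part 8's (M) socket).
* §3 X3♯(M) and X3♯(G-ord, `e = 2`) ∩ `I₀*` (`E[p]` REDUCIBLE — rational `p`-torsion possible, so the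
  certificate is stated as one non-zero `x ∈ Ш(E/ℚ)[p]`): the same for the Wuthrich element.

Census pointer (EVIDENCE, gen33/LOWER-HALF-READING.md; nothing booked): of the 72 rank-0 defect-2
`p ∣ #Ш_an` pairs N < 2·10⁴, 71 have `ord_p #Ш_an = 2` (54 X4(M) + 4 X4 Gord_e2 + 3 X3(M) + 2 X3 Gord_e2
at `p = 3` with `#Ш_an = 9`; 4 X4(M) + 4 X4 Gord_e2 at `p = 5` with `#Ш_an = 25`) — on each the ONE
missing input is a non-zero `p`-Selmer class; 19215t1 (`81` at `3`) needs `27 ∣ #Ш`.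

References: Cassels 1962 / Silverman *AEC* X.4.14 [SilvermanAEC2009]; Kato 2004 Thm. 17.4 (3)
[Kato2004Asterisque]; Wuthrich 2014 Thm. 16 [Wuthrich2014]; Delbourgo 2002 Thm. (A), (B) [Delbourgo2002];
Miller 2011 Def. 1.1 [Miller2011LMS]; x11b `Typed/CasselsLowerBound`, `Typed/SelmerCardCertificateRankZero`;
x10b `Supersingular/DescentLowerBound`; gen 32 part 8; gen 33 parts 1–2. -/

set_option autoImplicit false

noncomputable section

open scoped Classical MatrixGroups ModularForm NumberField

open CongruenceSubgroup IsDedekindDomain WeierstrassCurve NumberField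
  Literature.NumberTheory.EllipticCurves
  Literature.NumberTheory.EllipticCurves.ModularForms
  Literature.NumberTheory.EllipticCurves.Rank1Residual
  Literature.NumberTheory.EllipticCurves.Rank1Residual.Typed
  Literature.NumberTheory.EllipticCurves.Delbourgo2002
  Literature.NumberTheory.GaloisRepresentations
  Summit.BirchSwinnertonDyer.Rank1Residual.AdditivePotMult
  Summit.BirchSwinnertonDyer.Rank1Residual.X1.MuLambda
  Summit.BirchSwinnertonDyer.Rank1Residual.X1.RankOneParitySqueeze
  Summit.BirchSwinnertonDyer.Rank1Residual.X11a.LambdaNorm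

namespace Summit.BirchSwinnertonDyer.Rank1Residual.Additive

/-! ### §0 Class-free sockets: the certificate shapes that give `ord_p s ≤ ord_p #Ш[p^∞]` -/

namespace TameBranchAnalyticSha

variable {W : WeierstrassCurve ℚ} [W.IsElliptic] {p : ℕ} [hp : Fact p.Prime]

omit [W.IsElliptic] in
/-- **The typed lower half IS the socket.** If `Ш(E/ℚ)` is finite (GZK at `r_an ≤ 1`), the typed
`MissingLowerBoundAt W p` (`ord_p #Ш_an ≤ ord_p #Ш`) reads `ord_p s ≤ ord_p #Ш(E/ℚ)[p^∞]` for the rational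
`s = #Ш_an(E)` (`ord_p #Ш[p^∞] = ord_p #Ш`). Bookkeeping. [cite: Miller2011LMS, Def. 1.1 (arXiv:1010.2431 p. 3)] -/
theorem padicValRat_le_card_primaryComponent_of_missingLowerBoundAt (hfin : Finite W.sha)
    (hlow : MissingLowerBoundAt W p) {s : ℚ} (hs : shaAn W = (s : ℂ)) :
    padicValRat p s ≤ padicValNat p (Nat.card (AddCommGroup.primaryComponent W.sha p)) := by
  obtain ⟨q, hq, hle⟩ := hlow
  have hqs : q = s := by exact_mod_cast hq.symm.trans hs
  subst hqs
  haveI := hfin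
  rw [padicValNat_card_addPrimaryComponent (A := W.sha) p, ← WeierstrassCurve.shaOrder]
  exact hle

/-- **Socket from `p^{2k−1} ∣ #Ш(E/ℚ)` when `ord_p #Ш_an ≤ 2k`.** Cassels–Tate squareness (`hCT`) makes
`ord_p #Ш` even, so the odd step is free (x11b's `missingLowerBoundAt_of_casselsTate_of_pow_dvd`).
[cite: SilvermanAEC2009, Thm. X.4.14] [cite: Miller2011LMS, Def. 1.1 (arXiv:1010.2431 p. 3)] -/
theorem padicValRat_le_card_primaryComponent_of_pow_dvd_shaOrder
    (hCT : exists_casselsTate_pairing (K := ℚ)) (hfin : Finite W.sha) {s : ℚ} (hs : shaAn W = (s : ℂ))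
    {k : ℕ} (hsk : padicValRat p s ≤ 2 * k) (hdvd : p ^ (2 * k - 1) ∣ W.shaOrder) :
    padicValRat p s ≤ padicValNat p (Nat.card (AddCommGroup.primaryComponent W.sha p)) :=
  padicValRat_le_card_primaryComponent_of_missingLowerBoundAt hfin
    (missingLowerBoundAt_of_casselsTate_of_pow_dvd W p hCT hfin hs hsk hdvd) hs

/-- **Socket from ONE non-zero element of `Ш(E/ℚ)[p]` when `ord_p #Ш_an ≤ 2`** (`p ∣ #Ш`, hence `p² ∣ #Ш`
by Cassels–Tate). [cite: SilvermanAEC2009, Thm. X.4.14] [cite: Miller2011LMS, Def. 1.1 (arXiv:1010.2431 p. 3)] -/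
theorem padicValRat_le_card_primaryComponent_of_exists_sha_torsion
    (hCT : exists_casselsTate_pairing (K := ℚ)) (hfin : Finite W.sha) {s : ℚ} (hs : shaAn W = (s : ℂ))
    (hs2 : padicValRat p s ≤ 2) (hx : ∃ x : W.sha, x ≠ 0 ∧ p • x = 0) :
    padicValRat p s ≤ padicValNat p (Nat.card (AddCommGroup.primaryComponent W.sha p)) :=
  padicValRat_le_card_primaryComponent_of_pow_dvd_shaOrder hCT hfin hs (k := 1) (by simpa using hs2)
    (by simpa using dvd_shaOrder_of_exists_torsion W p hx)

/-- **Socket from the native `p`-descent line `Sel^(p)(E/ℚ) ≠ 0`** at analytic rank `0` with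
`p ∤ #E(ℚ)_tors` and `ord_p #Ш_an ≤ 2`: rank `0` and `Ш` finite by GZK, `Sel^(p) ≅ Ш[p]` by the PROVED
fundamental descent sequence (x10b's class-free `missingLowerBoundAt_of_casselsTate_of_selmerGroup_ne_bot`).
[cite: SilvermanAEC2009, Thm. X.4.2 and X.4.14] [cite: Miller2011LMS, Def. 1.1 (arXiv:1010.2431 p. 3)] -/
theorem padicValRat_le_card_primaryComponent_of_selmerGroup_ne_bot
    (hCT : exists_casselsTate_pairing (K := ℚ)) (hGZK : rank_eq_analyticRank_of_analyticRank_le_one)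
    (hr : W.analyticRank = 0) (htors : ¬ p ∣ W.torsionOrder) {s : ℚ} (hs : shaAn W = (s : ℂ))
    (hs2 : padicValRat p s ≤ 2) (hSel : W.selmerGroup (p : ℤ) ≠ ⊥) :
    padicValRat p s ≤ padicValNat p (Nat.card (AddCommGroup.primaryComponent W.sha p)) :=
  padicValRat_le_card_primaryComponent_of_missingLowerBoundAt (hGZK W (by rw [hr]; norm_num)).2
    (Supersingular.missingLowerBoundAt_of_casselsTate_of_selmerGroup_ne_bot W p hCT hGZK hr htors hs hs2
      hSel) hs

end TameBranchAnalyticSha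

/-! ### §1 X4♯(G-ord, `e = 2`) ∩ {`ρ̄` onto}, every odd `p`: the `p`-descent line closes the `p ∣ #Ш_an` rows -/

section X4Gord

open TameBranchMuPart TameBranchAnalyticSha

variable {W : WeierstrassCurve ℚ} [W.IsElliptic] [W.IsGloballyMinimal] {p : ℕ} [hp : Fact p.Prime]

/-- **X4♯(G-ord) ∩ {`ρ̄_{E,p}` onto}, RANK 0, `ord_p #Ш_an(E) ≤ 2`: ONE NON-ZERO `p`-SELMER CLASS CERTIFIES
`BSD(E,p)` AND THE MAIN CONJECTURE AT THE PAIR.** `p` odd (`p = 3` included), a (B)-datum `Dh`, twist data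
`(V, C, f, ϖ)`; inputs Kato 17.4 (3) (`hK`), Cassels–Tate (`hCT`), GZK, modularity; certificate
**`Sel^(p)(E/ℚ) ≠ 0`** (`p ∤ #E(ℚ)_tors` is automatic: `E[p]` irreducible). Then **`BSD(E,p)`**,
**`ord_p #Ш(E/ℚ)[p^∞] = ord_p #Ш_an(E)`**, and for every cyclotomic dual datum **the Kato element generates
`char_Λ X(E/ℚ_∞)`** (`ι g = u·ϖ·B^±`) with Delbourgo's **`ℓ = 1`**. Census rows (`#Ш_an = 25` at `5`): 2900d1,
10850m1, 16900k1, 19350cb1; (`9` at `3`): 3555e1, 14976k1, 16074b1, 16830p1. Per-pair; NOT a class theorem.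
[cite: Kato2004Asterisque, Thm. 17.4 (3) (p. 273)] [cite: SilvermanAEC2009, Thm. X.4.2 and X.4.14]
[cite: Delbourgo2002, Theorem (B) (p. 40)] [cite: Miller2011LMS, Def. 1.1 (arXiv:1010.2431 p. 3)] -/
theorem ClassX4Gord.bsdp_and_charIdeal_eq_span_kato_of_selmerGroup_ne_bot_rankZero_odd
    (hK : Wuthrich2014.kato_halfEigenCharIdeal_dvd_cyclotomicPrime_of_surjective)
    (hCT : exists_casselsTate_pairing (K := ℚ))
    (hGZK : rank_eq_analyticRank_of_analyticRank_le_one) (hmod : hasEntireLFunction_rat)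
    (hX : ClassX4Gord W p) (hsurj : Surj W p) (hr : W.analyticRank = 0)
    {Dh : PAdicHeightData W p} (hBcl : LeadingTermClauses W p Dh)
    {s : ℚ} (hs : shaAn W = (s : ℂ)) (hs2 : padicValRat p s ≤ 2) (hSel : W.selmerGroup (p : ℤ) ≠ ⊥)
    (V : WeierstrassCurve ℚ) [V.IsElliptic] [V.IsGloballyMinimal] (C : VariableChange ℚ)
    (hC : C • V.quadraticTwist ((-1 : ℚ) ^ (p / 2) * p) = W) (hV : GoodOrd V p)
    {N : ℕ} [NeZero N] {f : CuspForm (Gamma0 N) 2} (hf : IsNewformOf V f)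
    (ϖ : ℚ) (hϖ : if Even (p / 2) then (ϖ : ℝ) * V.realPeriodRat = plusPeriod f
      else (ϖ : ℝ) * V.imaginaryPeriodRat = minusPeriod f)
    {κ : ZpExtension ℚ p} {γ : Field.absoluteGaloisGroup ℚ}
    (hκ : κ.IsCyclotomic) (hγ : κ.IsTopGenerator γ) (hγ' : IsCyclotomicVariable p γ)
    (D : W.SelmerDualData κ γ) :
    BSDp W p ∧ (padicValNat p (Nat.card (AddCommGroup.primaryComponent W.sha p)) : ℤ) = padicValRat p s ∧
      ∃ (g : IwasawaAlgebra p) (u : ℤ_[p]ˣ) (ℓ : ℕ), D.charIdeal = Ideal.span {g} ∧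
        iwasawaToPowerSeries p g = PowerSeries.C (((u : ℤ_[p]) : ℚ_[p]) * (ϖ : ℚ_[p])) *
          (if Even (p / 2) then padicLFunctionBranch f ((unitRoot V p : ℤ_[p]) : ℚ_[p]) (p / 2)
            else padicLFunctionMinusBranch f ((unitRoot V p : ℤ_[p]) : ℚ_[p]) (p / 2)) ∧
        ℓ ∣ p ^ 2 ∧ ℓ = 1 ∧
        (padicValNat p (Nat.card (AddCommGroup.primaryComponent W.sha p)) : ℤ) + padicValNat p ℓ =
          padicValRat p s := by
  have htors : ¬ p ∣ W.torsionOrder := Supersingular.not_dvd_torsionOrder_of_irr W p hX.classX4.2.2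
  have hlow := padicValRat_le_card_primaryComponent_of_selmerGroup_ne_bot hCT hGZK hr htors hs hs2 hSel
  exact hX.bsdp_and_charIdeal_eq_span_kato_of_shaAn_le_card_rankZero_odd hK hGZK hmod hsurj hr hBcl hs hlow V C
    hC hV hf ϖ hϖ hκ hγ hγ' D

/-- **X4♯(G-ord) ∩ {`ρ̄` onto}, RANK 0, `ord_p #Ш_an(E) ≤ 2k`: the certificate `p^{2k−1} ∣ #Ш(E/ℚ)`** (e.g.
`dim_{𝔽_p} Ш(E)[p] ≥ 2k−1` from a `p`-descent; Cassels–Tate supplies the last factor `p`) ⟹ `BSD(E,p)`,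
`ord_p #Ш[p^∞] = ord_p #Ш_an`, MC at the pair, `ℓ = 1`. Census: 19215t1 at `3` (`#Ш_an = 81`, `k = 2`:
`27 ∣ #Ш`). [cite: Kato2004Asterisque, Thm. 17.4 (3) (p. 273)] [cite: SilvermanAEC2009, Thm. X.4.14]
[cite: Delbourgo2002, Theorem (B) (p. 40)] [cite: Miller2011LMS, Def. 1.1 (arXiv:1010.2431 p. 3)] -/
theorem ClassX4Gord.bsdp_and_charIdeal_eq_span_kato_of_pow_dvd_shaOrder_rankZero_odd
    (hK : Wuthrich2014.kato_halfEigenCharIdeal_dvd_cyclotomicPrime_of_surjective)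
    (hCT : exists_casselsTate_pairing (K := ℚ))
    (hGZK : rank_eq_analyticRank_of_analyticRank_le_one) (hmod : hasEntireLFunction_rat)
    (hX : ClassX4Gord W p) (hsurj : Surj W p) (hr : W.analyticRank = 0)
    {Dh : PAdicHeightData W p} (hBcl : LeadingTermClauses W p Dh)
    {s : ℚ} (hs : shaAn W = (s : ℂ)) {k : ℕ} (hsk : padicValRat p s ≤ 2 * k)
    (hdvd : p ^ (2 * k - 1) ∣ W.shaOrder)
    (V : WeierstrassCurve ℚ) [V.IsElliptic] [V.IsGloballyMinimal] (C : VariableChange ℚ)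
    (hC : C • V.quadraticTwist ((-1 : ℚ) ^ (p / 2) * p) = W) (hV : GoodOrd V p)
    {N : ℕ} [NeZero N] {f : CuspForm (Gamma0 N) 2} (hf : IsNewformOf V f)
    (ϖ : ℚ) (hϖ : if Even (p / 2) then (ϖ : ℝ) * V.realPeriodRat = plusPeriod f
      else (ϖ : ℝ) * V.imaginaryPeriodRat = minusPeriod f)
    {κ : ZpExtension ℚ p} {γ : Field.absoluteGaloisGroup ℚ}
    (hκ : κ.IsCyclotomic) (hγ : κ.IsTopGenerator γ) (hγ' : IsCyclotomicVariable p γ)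
    (D : W.SelmerDualData κ γ) :
    BSDp W p ∧ (padicValNat p (Nat.card (AddCommGroup.primaryComponent W.sha p)) : ℤ) = padicValRat p s ∧
      ∃ (g : IwasawaAlgebra p) (u : ℤ_[p]ˣ) (ℓ : ℕ), D.charIdeal = Ideal.span {g} ∧
        iwasawaToPowerSeries p g = PowerSeries.C (((u : ℤ_[p]) : ℚ_[p]) * (ϖ : ℚ_[p])) *
          (if Even (p / 2) then padicLFunctionBranch f ((unitRoot V p : ℤ_[p]) : ℚ_[p]) (p / 2)
            else padicLFunctionMinusBranch f ((unitRoot V p : ℤ_[p]) : ℚ_[p]) (p / 2)) ∧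
        ℓ ∣ p ^ 2 ∧ ℓ = 1 ∧
        (padicValNat p (Nat.card (AddCommGroup.primaryComponent W.sha p)) : ℤ) + padicValNat p ℓ =
          padicValRat p s := by
  have hlow := padicValRat_le_card_primaryComponent_of_pow_dvd_shaOrder hCT (hGZK W (by rw [hr]; norm_num)).2
    hs hsk hdvd
  exact hX.bsdp_and_charIdeal_eq_span_kato_of_shaAn_le_card_rankZero_odd hK hGZK hmod hsurj hr hBcl hs hlow V C
    hC hV hf ϖ hϖ hκ hγ hγ' D

/-- **`p = 3` headline: `Sel^(3)(E/ℚ) ≠ 0` on a rank-0 X4♯(G-ord) ∩ `I₀*` ∩ {`ρ̄_{E,3}` onto} non-CM curve with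
`#Ш_an = 9` ⟹ `BSD(E,3)` and `#Ш(E/ℚ)[3^∞] = 9`** (binder discharged by `mainTheorem_three`; twist datum by
BCDT). The cell's exact `3`-descent engines produce the certificate line. [cite: Kato2004Asterisque, Thm. 17.4 (3) (p. 273)]
[cite: SilvermanAEC2009, Thm. X.4.2 and X.4.14] [cite: Delbourgo2002, Theorem (A), (B) (p. 40)]
[cite: Miller2011LMS, Def. 1.1 (arXiv:1010.2431 p. 3)] -/
theorem ClassX4Gord.bsdp_three_of_katoHalf_of_selmerThree_ne_bot_rankZero [Fact (Nat.Prime 3)]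
    (hK : Wuthrich2014.kato_halfEigenCharIdeal_dvd_cyclotomicPrime_of_surjective)
    (hCT : exists_casselsTate_pairing (K := ℚ)) (hmodD : nonempty_modularParametrizationData)
    (hDel3 : Delbourgo2002.mainTheorem_three)
    (hGZK : rank_eq_analyticRank_of_analyticRank_le_one) (hmod : hasEntireLFunction_rat)
    (hX : ClassX4Gord W 3) (hcm : ¬ W.HasCM) (hsurj : Surj W 3)
    (hr : W.analyticRank = 0) {s : ℚ} (hs : shaAn W = (s : ℂ)) (hs2 : padicValRat 3 s ≤ 2)
    (hSel : W.selmerGroup (3 : ℤ) ≠ ⊥) :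
    BSDp W 3 ∧ (padicValNat 3 (Nat.card (AddCommGroup.primaryComponent W.sha 3)) : ℤ) = padicValRat 3 s := by
  have htors : ¬ 3 ∣ W.torsionOrder := Supersingular.not_dvd_torsionOrder_of_irr W 3 hX.classX4.2.2
  have hlow := padicValRat_le_card_primaryComponent_of_selmerGroup_ne_bot hCT hGZK hr htors hs hs2
    (by exact_mod_cast hSel)
  exact hX.bsdp_three_of_katoHalf_of_shaAn_le_card_rankZero hK hmodD hDel3 hGZK hmod hcm hsurj hr hs hlow

end X4Gord

/-! ### §2 X4(M) ∩ {`ρ̄` onto}, every odd `p` -/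

section X4M

open TameBranchMuPart TameBranchAnalyticSha

variable {W : WeierstrassCurve ℚ} [W.IsElliptic] [W.IsGloballyMinimal] {p : ℕ} [hp : Fact p.Prime]

/-- **X4(M) ∩ {`ρ̄_{E,p}` onto}, RANK 0, `ord_p #Ш_an(E) ≤ 2`: ONE NON-ZERO `p`-SELMER CLASS CERTIFIES
`BSD(E,p)` AND THE MAIN CONJECTURE AT THE PAIR.** EVERY odd `p`, a (B)-datum (`mainTheorem_potMult`),
multiplicative twist data `(V, C, f, ϖ)`; inputs Kato 17.4 (3), Cassels–Tate, GZK, modularity;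
certificate **`Sel^(p)(E/ℚ) ≠ 0`**. Then `BSD(E,p)`, `ord_p #Ш[p^∞] = ord_p #Ш_an`, the Kato element
(`ι g = u·ϖ·L^±_p(f, a_p(V))`) generates `char_Λ X(E/ℚ_∞)`, `ℓ = 1`. Census: 54 rows at `3` (`#Ш_an = 9`;
the HXZ-b rows carry a two-engine `3`-descent record `dim Ш[3] = 2`), 4 at `5` (12300e1, 15300s1, 16800i1,
19600by1; `#Ш_an = 25`). Per-pair; NOT a class theorem. [cite: Kato2004Asterisque, Thm. 17.4 (3) (p. 273)]
[cite: SilvermanAEC2009, Thm. X.4.2 and X.4.14] [cite: Delbourgo2002, Theorem (A), (B) (p. 40), p. 39]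
[cite: Miller2011LMS, Def. 1.1 (arXiv:1010.2431 p. 3)] -/
theorem ClassX4M.bsdp_and_charIdeal_eq_span_kato_of_selmerGroup_ne_bot_rankZero
    (hK : Wuthrich2014.kato_halfEigenCharIdeal_dvd_cyclotomicPrime_of_surjective)
    (hCT : exists_casselsTate_pairing (K := ℚ))
    (hGZK : rank_eq_analyticRank_of_analyticRank_le_one) (hmod : hasEntireLFunction_rat)
    (hX : ClassX4M W p) (hsurj : Surj W p) (hr : W.analyticRank = 0)
    {Dh : PAdicHeightData W p} (hBcl : LeadingTermClauses W p Dh)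
    {s : ℚ} (hs : shaAn W = (s : ℂ)) (hs2 : padicValRat p s ≤ 2) (hSel : W.selmerGroup (p : ℤ) ≠ ⊥)
    (V : WeierstrassCurve ℚ) [V.IsElliptic] [V.IsGloballyMinimal] (C : VariableChange ℚ)
    (hC : C • V.quadraticTwist ((-1 : ℚ) ^ (p / 2) * p) = W) (hV : Mult V p)
    {N : ℕ} [NeZero N] {f : CuspForm (Gamma0 N) 2} (hf : IsNewformOf V f)
    (ϖ : ℚ) (hϖ : if Even (p / 2) then (ϖ : ℝ) * V.realPeriodRat = plusPeriod f
      else (ϖ : ℝ) * V.imaginaryPeriodRat = minusPeriod f)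
    {κ : ZpExtension ℚ p} {γ : Field.absoluteGaloisGroup ℚ}
    (hκ : κ.IsCyclotomic) (hγ : κ.IsTopGenerator γ) (hγ' : IsCyclotomicVariable p γ)
    (D : W.SelmerDualData κ γ) :
    BSDp W p ∧ ∃ (g : IwasawaAlgebra p) (u : ℤ_[p]ˣ) (ℓ : ℕ), D.charIdeal = Ideal.span {g} ∧
      iwasawaToPowerSeries p g = PowerSeries.C (((u : ℤ_[p]) : ℚ_[p]) * (ϖ : ℚ_[p])) *
        (if Even (p / 2) then padicLFunctionPlusBranchMult f ((V.LFunction p : ℤ) : ℚ_[p]) (p / 2)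
          else padicLFunctionMinusBranchMult f ((V.LFunction p : ℤ) : ℚ_[p]) (p / 2)) ∧
      ℓ ∣ p ^ 2 ∧ ℓ = 1 ∧
      (padicValNat p (Nat.card (AddCommGroup.primaryComponent W.sha p)) : ℤ) = padicValRat p s := by
  have htors : ¬ p ∣ W.torsionOrder := Supersingular.not_dvd_torsionOrder_of_irr W p hX.1.2.2
  have hlow := padicValRat_le_card_primaryComponent_of_selmerGroup_ne_bot hCT hGZK hr htors hs hs2 hSel
  exact ClassX4M.bsdp_and_charIdeal_eq_span_kato_of_shaAn_le_card_rankZero hK hGZK hmod hX hsurj hr hBcl hs hlow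
    V C hC hV hf ϖ hϖ hκ hγ hγ' D

end X4M

/-! ### §3 X3♯(M) and X3♯(G-ord, `e = 2`) ∩ `I₀*` (`E[p]` reducible), every odd `p` -/

section X3

open TameBranchMuPart TameBranchAnalyticSha

variable {W : WeierstrassCurve ℚ} [W.IsElliptic] [W.IsGloballyMinimal] {p : ℕ} [hp : Fact p.Prime]

/-- **X3♯(M), RANK 0, `ord_p #Ш_an(E) ≤ 2`: ONE NON-ZERO ELEMENT OF `Ш(E/ℚ)[p]` CERTIFIES `BSD(E,p)` AND
THE MAIN CONJECTURE AT THE PAIR** (`E[p]` reducible, so the certificate is stated on `Ш`, not on `Sel^(p)`).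
EVERY odd `p`; inputs Wuthrich Thm. 16 (`hWu`), Cassels–Tate, GZK, modularity, the (B)-datum. Census:
8190bz1, 13860x1, 15138i1 at `3` (`#Ш_an = 9`). [cite: Wuthrich2014, Thm. 16 (p. 397)]
[cite: SilvermanAEC2009, Thm. X.4.14] [cite: Delbourgo2002, Theorem (A), (B) (p. 40), p. 39]
[cite: Miller2011LMS, Def. 1.1 (arXiv:1010.2431 p. 3)] -/
theorem ClassX3M.bsdp_and_charIdeal_eq_span_wuthrich_of_exists_sha_torsion_rankZero
    (hWu : Wuthrich2014.thm16_halfEigenCharIdeal_dvd_cyclotomicPrime)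
    (hCT : exists_casselsTate_pairing (K := ℚ))
    (hGZK : rank_eq_analyticRank_of_analyticRank_le_one) (hmod : hasEntireLFunction_rat)
    (hX : ClassX3M W p) (hr : W.analyticRank = 0)
    {Dh : PAdicHeightData W p} (hBcl : LeadingTermClauses W p Dh)
    {s : ℚ} (hs : shaAn W = (s : ℂ)) (hs2 : padicValRat p s ≤ 2) (hx : ∃ x : W.sha, x ≠ 0 ∧ p • x = 0)
    (V : WeierstrassCurve ℚ) [V.IsElliptic] [V.IsGloballyMinimal] (C : VariableChange ℚ)
    (hC : C • V.quadraticTwist ((-1 : ℚ) ^ (p / 2) * p) = W) (hV : Mult V p)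
    {N : ℕ} [NeZero N] {f : CuspForm (Gamma0 N) 2} (hf : IsNewformOf V f)
    (ϖ : ℚ) (hϖ : if Even (p / 2) then (ϖ : ℝ) * V.realPeriodRat = plusPeriod f
      else (ϖ : ℝ) * V.imaginaryPeriodRat = minusPeriod f)
    {κ : ZpExtension ℚ p} {γ : Field.absoluteGaloisGroup ℚ}
    (hκ : κ.IsCyclotomic) (hγ : κ.IsTopGenerator γ) (hγ' : IsCyclotomicVariable p γ)
    (D : W.SelmerDualData κ γ) :
    BSDp W p ∧ ∃ (g : IwasawaAlgebra p) (u : ℤ_[p]ˣ) (ℓ : ℕ), D.charIdeal = Ideal.span {g} ∧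
      iwasawaToPowerSeries p g = PowerSeries.C (((u : ℤ_[p]) : ℚ_[p]) * (ϖ : ℚ_[p])) *
        (if Even (p / 2) then padicLFunctionPlusBranchMult f ((V.LFunction p : ℤ) : ℚ_[p]) (p / 2)
          else padicLFunctionMinusBranchMult f ((V.LFunction p : ℤ) : ℚ_[p]) (p / 2)) ∧
      ℓ ∣ p ^ 2 ∧ ℓ = 1 ∧
      (padicValNat p (Nat.card (AddCommGroup.primaryComponent W.sha p)) : ℤ) = padicValRat p s := by
  have hlow := padicValRat_le_card_primaryComponent_of_exists_sha_torsion hCT (hGZK W (by rw [hr]; norm_num)).2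
    hs hs2 hx
  exact ClassX3M.bsdp_and_charIdeal_eq_span_wuthrich_of_shaAn_le_card_rankZero hWu hGZK hmod hX hr hBcl hs hlow V
    C hC hV hf ϖ hϖ hκ hγ hγ' D

/-- **X3♯(G-ord, `e = 2`) ∩ `I₀*`, RANK 0, `ord_p #Ш_an(E) ≤ 2`: ONE NON-ZERO ELEMENT OF `Ш(E/ℚ)[p]` CERTIFIES
`BSD(E,p)` AND THE MAIN CONJECTURE AT THE PAIR.** EVERY odd `p`, a (B)-datum (A175 / `mainTheorem_three`),
good-ordinary twist data; inputs Wuthrich Thm. 16, Cassels–Tate, GZK, modularity. Census: 7632m1, 19530cg1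
at `3` (`#Ш_an = 9`). [cite: Wuthrich2014, Thm. 16 (p. 397)] [cite: SilvermanAEC2009, Thm. X.4.14]
[cite: Delbourgo2002, Theorem (A), (B) (p. 40)] [cite: Miller2011LMS, Def. 1.1 (arXiv:1010.2431 p. 3)] -/
theorem ClassX3Gord.bsdp_and_charIdeal_eq_span_wuthrich_of_exists_sha_torsion_rankZero
    (hWu : Wuthrich2014.thm16_halfEigenCharIdeal_dvd_cyclotomicPrime)
    (hCT : exists_casselsTate_pairing (K := ℚ))
    (hGZK : rank_eq_analyticRank_of_analyticRank_le_one) (hmod : hasEntireLFunction_rat)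
    (hX : ClassX3Gord W p) (hp2 : p ≠ 2) (hr : W.analyticRank = 0)
    {Dh : PAdicHeightData W p} (hBcl : LeadingTermClauses W p Dh)
    {s : ℚ} (hs : shaAn W = (s : ℂ)) (hs2 : padicValRat p s ≤ 2) (hx : ∃ x : W.sha, x ≠ 0 ∧ p • x = 0)
    (V : WeierstrassCurve ℚ) [V.IsElliptic] [V.IsGloballyMinimal] (C : VariableChange ℚ)
    (hC : C • V.quadraticTwist ((-1 : ℚ) ^ (p / 2) * p) = W) (hV : GoodOrd V p)
    {N : ℕ} [NeZero N] {f : CuspForm (Gamma0 N) 2} (hf : IsNewformOf V f)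
    (ϖ : ℚ) (hϖ : if Even (p / 2) then (ϖ : ℝ) * V.realPeriodRat = plusPeriod f
      else (ϖ : ℝ) * V.imaginaryPeriodRat = minusPeriod f)
    {κ : ZpExtension ℚ p} {γ : Field.absoluteGaloisGroup ℚ}
    (hκ : κ.IsCyclotomic) (hγ : κ.IsTopGenerator γ) (hγ' : IsCyclotomicVariable p γ)
    (D : W.SelmerDualData κ γ) :
    BSDp W p ∧ ∃ (g : IwasawaAlgebra p) (u : ℤ_[p]ˣ) (ℓ : ℕ), D.charIdeal = Ideal.span {g} ∧
      iwasawaToPowerSeries p g = PowerSeries.C (((u : ℤ_[p]) : ℚ_[p]) * (ϖ : ℚ_[p])) *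
        (if Even (p / 2) then padicLFunctionBranch f ((unitRoot V p : ℤ_[p]) : ℚ_[p]) (p / 2)
          else padicLFunctionMinusBranch f ((unitRoot V p : ℤ_[p]) : ℚ_[p]) (p / 2)) ∧
      ℓ ∣ p ^ 2 ∧ ℓ = 1 ∧
      (padicValNat p (Nat.card (AddCommGroup.primaryComponent W.sha p)) : ℤ) = padicValRat p s := by
  have hlow := padicValRat_le_card_primaryComponent_of_exists_sha_torsion hCT (hGZK W (by rw [hr]; norm_num)).2
    hs hs2 hx
  exact hX.bsdp_and_charIdeal_eq_span_wuthrich_of_shaAn_le_card_rankZero hWu hGZK hmod hp2 hr hBcl hs hlow V C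
    hC hV hf ϖ hϖ hκ hγ hγ' D

end X3

end Summit.BirchSwinnertonDyer.Rank1Residual.Additive

end
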